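import Literature.Topology.FourManifolds.HandlePlanarMap
import Literature.Topology.FourManifolds.IwasePolarModel
import Mathlib.Analysis.SpecialFunctions.Trigonometric.InverseDeriv
import HarnessLib

/-!
# The handle embedding of the Iwase model

Auxiliary construction for the model datum of Iwase's Proposition 3.5
[cite: Iwase1988, Prop. 3.5, p. 296] (`Iwase1988_gluckTwist_isTorusLinkSurgery`, reduced to a
model problem on `S² × ℝ²` in `TorusSurgeryIwaseReduction`).  The unknotted torus of the model
is a graph part over the sphere (handled by the polar model `IwasePolarModel`) plus a *handle*
joining the two polar columns over the top of an arch.  This file constructs the handle chart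
`h : (0, 1) × {‖ζ‖ < 23/10} × {|c| < 23/10} → S² × ℝ²` (`handleMap`) and proves that it is a
smooth bijection onto an open set `Hset` with smooth explicit inverse `handleInv`.

* `Kfun`, `kfun`, `mfun`: the squared column scale `K(s)` (`= 1 - r(s)` on the band
  `s ≤ 1/500`, mirror-symmetric, with values in `[1/100, 3/100]`), `k = √K`, and the slope
  `m = K/(1 - K)` of the affine slice profile; built with the smooth clamp `sclamp`.
* `betaOf`, `alphaOf`: the Fermi-type angles of the chart point `(k Re ζ, k Im ζ, √(1 - k²|ζ|²))`;
  `fermi σ β = (cos β sin σ, sin β, cos β cos σ) ∈ S²`; `mirrorS2`.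
* `handleMap (s, ζ, c) = (fermi σ̃ β, r e^{ic})` with `a = -(2/π) α`,
  `(X'', Y'') = bentStrip (s, a)` (`HandlePlanarMap`), `σ̃ = (X'' + 1) π/2`, `r = 49/50 + Y''`.
  At the two ends (`s ≤ 1/10`, `s ≥ 9/10`) this is *exactly* the rotationally equivariant chart
  `y = k ζ`, `x₂ = ±√(1 - k²|ζ|²)`, `w = (49/50 + tan (π s)) e^{ic}` (`handleMap_coe_fst_of_le`,
  `ycoord_handleMap_of_le`, `handleMap_mul_of_le`), and `h(1 - s, ζ, c)` is the mirror image of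
  `h(s, ζ, c)` (`handleMap_one_sub`).
* `handleInv`: the closed-form inverse (`r = ‖w‖`, `c = arg w`, `σ̃ = arg (x₀ - i x₂) + π/2`,
  `(s, a) = bentStripInv (2σ̃/π - 1, r - 49/50)`, `ζ = (sin α cos β + i sin β)/k(s)`), with
  `handleInv_handleMap` on `[0, 1] × {‖ζ‖ ≤ 5/2} × (-π, π]` and `handleMap_handleInv` where
  `|x₁| < 1`, `|a| ≤ 1`.
* Smoothness: `contMDiffAt_handleMap` (`‖ζ‖ < 5/2`), `contMDiffAt_handleInv` under the open
  regularity conditions `Good`; the handle `Hset = h(Ubox)` is open (`isOpen_Hset`,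
  `image_handleMap_Ubox`, `bijOn_handleMap`), and mirror-symmetric (`mirror_mem_Hset`).

All statements are elementary calculus [folklore]; the design (exact equivariant ends, explicit
inverse) is ours and replaces the tubular-neighbourhood argument of the source.

## References
* Z. Iwase, *Dehn-surgery along a torus T²-knot*, Pacific J. Math. 133 (1988), 289–299,
  Prop. 3.5. [cite: Iwase1988]
-/

open scoped ContDiff Manifold Topology
open Set Function Real Metric

noncomputable section

namespace Literature.Topology.FourManifolds

namespace IwaseHandle

open HandlePlanar

/-! ### The clamp and the column scale -/

/-- The smooth clamp `s (1 - ST((s² - s₀²)/(s₁² - s₀²)))`, `s₀ = 1/500`, `s₁ = 3/1000`: equal to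
`s` for `|s| ≤ s₀`, to `0` for `|s| ≥ s₁`, always of absolute value `≤ s₁`. [folklore] -/
def sclamp (s : ℝ) : ℝ := s * (1 - smoothTransition ((s ^ 2 - 1 / 250000) / (1 / 200000)))

/-- `sclamp s = s` for `s² ≤ s₀²`. [folklore] -/
theorem sclamp_eq_self {s : ℝ} (h : s ^ 2 ≤ 1 / 250000) : sclamp s = s := by
  rw [sclamp, smoothTransition.zero_of_nonpos
    (div_nonpos_of_nonpos_of_nonneg (by linarith) (by norm_num))]
  ring

/-- `sclamp s = 0` for `s² ≥ s₁²`. [folklore] -/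
theorem sclamp_eq_zero {s : ℝ} (h : 9 / 1000000 ≤ s ^ 2) : sclamp s = 0 := by
  rw [sclamp, smoothTransition.one_of_one_le ((one_le_div (by norm_num)).2 (by linarith))]
  ring

/-- `|sclamp s| ≤ |s|`. [folklore] -/
theorem abs_sclamp_le_abs (s : ℝ) : |sclamp s| ≤ |s| := by
  rw [sclamp, abs_mul]
  refine mul_le_of_le_one_right (abs_nonneg _) (abs_le.2 ⟨?_, ?_⟩)
  · linarith [smoothTransition.le_one ((s ^ 2 - 1 / 250000) / (1 / 200000))]
  · linarith [smoothTransition.nonneg ((s ^ 2 - 1 / 250000) / (1 / 200000))]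

/-- `|sclamp s| ≤ s₁ = 3/1000`. [folklore] -/
theorem abs_sclamp_le (s : ℝ) : |sclamp s| ≤ 3 / 1000 := by
  by_cases h : 9 / 1000000 ≤ s ^ 2
  · rw [sclamp_eq_zero h, abs_zero]; norm_num
  · push Not at h
    exact (abs_sclamp_le_abs s).trans
      (abs_le_of_sq_le_sq (by norm_num; exact h.le) (by norm_num))

/-- The clamp is smooth. [folklore] -/
theorem contDiff_sclamp : ContDiff ℝ ∞ sclamp :=
  contDiff_id.mul (contDiff_const.sub (smoothTransition.contDiff.comp
    (((contDiff_id.pow 2).sub contDiff_const).div_const _)))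

/-- A small-angle tangent bound: `|tan (π t)| ≤ 1/100` for `|t| ≤ 3/1000`. [folklore] -/
theorem abs_tan_pi_mul_le {t : ℝ} (ht : |t| ≤ 3 / 1000) : |tan (π * t)| ≤ 1 / 100 := by
  have hπ : π < 3.15 := pi_lt_d2
  have hx : |π * t| ≤ 0.00945 := by
    rw [abs_mul, abs_of_pos pi_pos]; nlinarith [pi_pos, abs_nonneg t]
  have hcos : 0.999 ≤ cos (π * t) := by
    have h1 := Real.one_sub_sq_div_two_le_cos (x := π * t)
    have h2 : (π * t) ^ 2 ≤ 0.00945 ^ 2 := by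
      rw [← sq_abs]; exact pow_le_pow_left₀ (abs_nonneg _) hx 2
    linarith
  have hcpos : 0 < cos (π * t) := by linarith
  rw [tan_eq_sin_div_cos, abs_div, abs_of_pos hcpos, div_le_iff₀ hcpos]
  have := abs_sin_le_abs (x := π * t)
  linarith

/-- `cos (π · sclamp s) > 0`. [folklore] -/
theorem cos_pi_mul_sclamp_pos (s : ℝ) : 0 < cos (π * sclamp s) := by
  have hπ : π < 3.15 := pi_lt_d2
  have hx : |π * sclamp s| ≤ 0.00945 := by
    rw [abs_mul, abs_of_pos pi_pos]; nlinarith [pi_pos, abs_nonneg (sclamp s), abs_sclamp_le s]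
  have h1 := Real.one_sub_sq_div_two_le_cos (x := π * sclamp s)
  have h2 : (π * sclamp s) ^ 2 ≤ 0.00945 ^ 2 := by
    rw [← sq_abs]; exact pow_le_pow_left₀ (abs_nonneg _) hx 2
  linarith

/-- `s ↦ tan (π · sclamp s)` is smooth (the clamp keeps the angle inside `(-π/2, π/2)`).
[folklore] -/
theorem contDiff_tan_sclamp : ContDiff ℝ ∞ fun s : ℝ => Real.tan (π * sclamp s) := by
  rw [contDiff_iff_contDiffAt]
  intro s
  have h1 : ContDiffAt ℝ ∞ Real.tan (π * sclamp s) :=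
    Real.contDiffAt_tan.2 (cos_pi_mul_sclamp_pos s).ne'
  have h2 : ContDiffAt ℝ ∞ (fun s : ℝ => π * sclamp s) s :=
    (contDiff_const.mul contDiff_sclamp).contDiffAt
  have h := h1.comp s h2
  exact h

/-- **The squared column scale** `K(s) = 1/50 - tan (π sclamp s) - tan (π sclamp (1 - s))`:
equal to `1/50 - tan (π s) = 1 - r(s)` at the north end of the handle (`0 ≤ s ≤ 1/500`, where
`r(s) = 49/50 + tan (π s)`), symmetric under `s ↦ 1 - s`, always in `[1/100, 3/100]`.
[folklore] -/
def Kfun (s : ℝ) : ℝ := 1 / 50 - tan (π * sclamp s) - tan (π * sclamp (1 - s))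

/-- `K` is mirror-symmetric. [folklore] -/
theorem Kfun_one_sub (s : ℝ) : Kfun (1 - s) = Kfun s := by
  rw [Kfun, Kfun, sub_sub_cancel]; ring

/-- `K(s) = 1/50 - tan (π s)` for `0 ≤ s ≤ 1/500`. [folklore] -/
theorem Kfun_eq_of_le {s : ℝ} (hs0 : 0 ≤ s) (hs : s ≤ 1 / 500) : Kfun s = 1 / 50 - tan (π * s) := by
  have h1 : sclamp s = s := sclamp_eq_self (by nlinarith)
  have h2 : sclamp (1 - s) = 0 := sclamp_eq_zero (by nlinarith)
  rw [Kfun, h1, h2, mul_zero, tan_zero, sub_zero]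

/-- `1/100 ≤ K ≤ 3/100` (the two clamps are never active simultaneously). [folklore] -/
theorem Kfun_mem (s : ℝ) : 1 / 100 ≤ Kfun s ∧ Kfun s ≤ 3 / 100 := by
  have ht1 := abs_le.1 (abs_tan_pi_mul_le (abs_sclamp_le s))
  have ht2 := abs_le.1 (abs_tan_pi_mul_le (abs_sclamp_le (1 - s)))
  by_cases h : 9 / 1000000 ≤ s ^ 2
  · rw [Kfun, sclamp_eq_zero h, mul_zero, tan_zero, sub_zero]
    constructor <;> linarith [ht2.1, ht2.2]
  · have h' : 9 / 1000000 ≤ (1 - s) ^ 2 := by nlinarith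
    rw [Kfun, sclamp_eq_zero h', mul_zero, tan_zero, sub_zero]
    constructor <;> linarith [ht1.1, ht1.2]

/-- `K > 0`. [folklore] -/
theorem Kfun_pos (s : ℝ) : 0 < Kfun s := by linarith [(Kfun_mem s).1]

/-- `K < 1`. [folklore] -/
theorem Kfun_lt_one (s : ℝ) : Kfun s < 1 := by linarith [(Kfun_mem s).2]

/-- `K` is smooth. [folklore] -/
theorem contDiff_Kfun : ContDiff ℝ ∞ Kfun :=
  (contDiff_const.sub contDiff_tan_sclamp).sub
    (contDiff_tan_sclamp.comp (contDiff_const.sub contDiff_id))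

/-- **The column scale** `k(s) = √K(s)` (`y = k ζ` at the ends of the handle). [folklore] -/
def kfun (s : ℝ) : ℝ := Real.sqrt (Kfun s)

/-- `k > 0`. [folklore] -/
theorem kfun_pos (s : ℝ) : 0 < kfun s := Real.sqrt_pos.2 (Kfun_pos s)

/-- `k² = K`. [folklore] -/
@[simp] theorem kfun_sq (s : ℝ) : kfun s ^ 2 = Kfun s := Real.sq_sqrt (Kfun_pos s).le

/-- `k` is mirror-symmetric. [folklore] -/
theorem kfun_one_sub (s : ℝ) : kfun (1 - s) = kfun s := by rw [kfun, kfun, Kfun_one_sub]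

/-- `k` is smooth. [folklore] -/
theorem contDiff_kfun : ContDiff ℝ ∞ kfun := contDiff_Kfun.sqrt fun s => (Kfun_pos s).ne'

/-- **The column slope** `m(s) = K/(1 - K)` (`= (1 - r)/r` at the ends), the parameter of the
affine slice profile `gaff m`. [folklore] -/
def mfun (s : ℝ) : ℝ := Kfun s / (1 - Kfun s)

/-- `m > 0`. [folklore] -/
theorem mfun_pos (s : ℝ) : 0 < mfun s := div_pos (Kfun_pos s) (by linarith [Kfun_lt_one s])

/-- `m` is mirror-symmetric. [folklore] -/
theorem mfun_one_sub (s : ℝ) : mfun (1 - s) = mfun s := by rw [mfun, mfun, Kfun_one_sub]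

/-- `m` is smooth. [folklore] -/
theorem contDiff_mfun : ContDiff ℝ ∞ mfun :=
  contDiff_Kfun.div (contDiff_const.sub contDiff_Kfun) fun s => by linarith [Kfun_lt_one s]

/-- The band `tan (π s) ≤ 1/200` of the north end lies inside `s ≤ 1/500`. [folklore] -/
theorem le_of_tan_le {s : ℝ} (hs0 : 0 ≤ s) (hs1 : s ≤ 1 / 10) (h : tan (π * s) ≤ 1 / 200) :
    s ≤ 1 / 500 := by
  have hπ3 : 3 < π := pi_gt_three
  have := Real.le_tan (x := π * s) (by positivity) (by nlinarith [pi_pos])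
  nlinarith

/-! ### Fermi-type angles of the end point `(k Re ζ, k Im ζ, √(1 - k²|ζ|²))` -/

/-- The latitude-type angle `β = arcsin (k Im ζ)`. [folklore] -/
def betaOf (k : ℝ) (ζ : ℂ) : ℝ := arcsin (k * ζ.im)

/-- The auxiliary `cos β = √(1 - (k Im ζ)²)`. [folklore] -/
def cbOf (k : ℝ) (ζ : ℂ) : ℝ := Real.sqrt (1 - (k * ζ.im) ^ 2)

/-- The meridian angle `α = arcsin (k Re ζ / cos β)`. [folklore] -/
def alphaOf (k : ℝ) (ζ : ℂ) : ℝ := arcsin (k * ζ.re / cbOf k ζ)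

section Angles

variable {k : ℝ} {ζ : ℂ}

/-- `(k Re ζ)² + (k Im ζ)² = k² ‖ζ‖²`. [folklore] -/
theorem sq_add_sq_eq (k : ℝ) (ζ : ℂ) : (k * ζ.re) ^ 2 + (k * ζ.im) ^ 2 = k ^ 2 * ‖ζ‖ ^ 2 := by
  rw [Complex.sq_norm, Complex.normSq_apply]; ring

/-- `cos β ≥ 2/√5 > 0` in the working range `k²‖ζ‖² ≤ 1/5`. [folklore] -/
theorem cbOf_pos (h : k ^ 2 * ‖ζ‖ ^ 2 ≤ 1 / 5) : 0 < cbOf k ζ :=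
  Real.sqrt_pos.2 (by nlinarith [sq_add_sq_eq k ζ, sq_nonneg (k * ζ.re)])

/-- `(cos β)² = 1 - (k Im ζ)²`. [folklore] -/
theorem cbOf_sq (h : k ^ 2 * ‖ζ‖ ^ 2 ≤ 1 / 5) : cbOf k ζ ^ 2 = 1 - (k * ζ.im) ^ 2 :=
  Real.sq_sqrt (by nlinarith [sq_add_sq_eq k ζ, sq_nonneg (k * ζ.re)])

/-- `sin β = k Im ζ`. [folklore] -/
theorem sin_betaOf (h : k ^ 2 * ‖ζ‖ ^ 2 ≤ 1 / 5) : sin (betaOf k ζ) = k * ζ.im := by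
  have h2 : (k * ζ.im) ^ 2 ≤ 1 := by nlinarith [sq_add_sq_eq k ζ, sq_nonneg (k * ζ.re)]
  obtain ⟨h3, h4⟩ := abs_le.1 (abs_le_of_sq_le_sq (show (k * ζ.im) ^ 2 ≤ 1 ^ 2 by
    rw [one_pow]; exact h2) zero_le_one)
  exact sin_arcsin h3 h4

/-- `cos β = cbOf`. [folklore] -/
theorem cos_betaOf (k : ℝ) (ζ : ℂ) : cos (betaOf k ζ) = cbOf k ζ := cos_arcsin _

/-- `(k Re ζ / cos β)² ≤ 1/5`. [folklore] -/
theorem div_sq_le (h : k ^ 2 * ‖ζ‖ ^ 2 ≤ 1 / 5) : (k * ζ.re / cbOf k ζ) ^ 2 ≤ 1 / 5 := by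
  have hc := cbOf_pos h
  rw [div_pow, div_le_iff₀ (by positivity), cbOf_sq h]
  nlinarith [sq_add_sq_eq k ζ]

/-- `sin α = k Re ζ / cos β`. [folklore] -/
theorem sin_alphaOf (h : k ^ 2 * ‖ζ‖ ^ 2 ≤ 1 / 5) : sin (alphaOf k ζ) = k * ζ.re / cbOf k ζ := by
  obtain ⟨h3, h4⟩ := abs_le.1 (abs_le_of_sq_le_sq (show (k * ζ.re / cbOf k ζ) ^ 2 ≤ 1 ^ 2 by
    linarith [div_sq_le h]) zero_le_one)
  exact sin_arcsin h3 h4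

/-- **`cos β sin α = k Re ζ`.** [folklore] -/
theorem cb_mul_sin_alphaOf (h : k ^ 2 * ‖ζ‖ ^ 2 ≤ 1 / 5) :
    cbOf k ζ * sin (alphaOf k ζ) = k * ζ.re := by
  rw [sin_alphaOf h, mul_div_cancel₀ _ (cbOf_pos h).ne']

/-- **`cos β cos α = √(1 - k²‖ζ‖²)`.** [folklore] -/
theorem cb_mul_cos_alphaOf (h : k ^ 2 * ‖ζ‖ ^ 2 ≤ 1 / 5) :
    cbOf k ζ * cos (alphaOf k ζ) = Real.sqrt (1 - k ^ 2 * ‖ζ‖ ^ 2) := by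
  have hc := cbOf_pos h
  rw [alphaOf, cos_arcsin, ← Real.sqrt_sq hc.le, ← Real.sqrt_mul (sq_nonneg _)]
  congr 1
  rw [Real.sqrt_sq hc.le, div_pow, mul_sub, mul_one, mul_div_cancel₀ _ (pow_ne_zero 2 hc.ne'),
    cbOf_sq h, ← sq_add_sq_eq]
  ring

/-- `|α| ≤ 47/100` (since `sin² α ≤ 1/5` and `sin 0.47 > 1/√5`). [folklore] -/
theorem abs_alphaOf_le (h : k ^ 2 * ‖ζ‖ ^ 2 ≤ 1 / 5) : |alphaOf k ζ| ≤ 47 / 100 := by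
  have hπ3 : 3 < π := pi_gt_three
  have hs47 : 0.4526 ≤ sin (0.47 : ℝ) := by
    have := Real.sin_gt_sub_cube (x := 0.47) (by norm_num)
    linarith
  have hsq := div_sq_le h
  set t := k * ζ.re / cbOf k ζ with ht
  have htabs : |t| ≤ 0.4473 := abs_le_of_sq_le_sq (by nlinarith) (by norm_num)
  obtain ⟨ht1, ht2⟩ := abs_le.1 htabs
  have hmem : (0.47 : ℝ) ∈ Icc (-(π / 2)) (π / 2) := ⟨by linarith, by linarith⟩
  have hmem' : (-0.47 : ℝ) ∈ Icc (-(π / 2)) (π / 2) := ⟨by linarith, by linarith⟩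
  rw [abs_le]
  constructor
  · have := (le_arcsin_iff_sin_le' (x := -0.47) (y := t) ⟨by linarith, by linarith⟩).2
      (by rw [sin_neg]; linarith)
    rw [alphaOf, ← ht]; linarith
  · have := (arcsin_le_iff_le_sin' (x := t) (y := 0.47) ⟨by linarith, by linarith⟩).2 (by linarith)
    rw [alphaOf, ← ht]; linarith

end Angles

/-! ### The spherical point `Y(σ, β) = (cos β sin σ, sin β, cos β cos σ)` -/

/-- The unit vector `Y(σ, β) = (cos β sin σ, sin β, cos β cos σ)` of `ℝ³` ("Fermi coordinates"
along the meridian `x₁ = 0` from the north pole `σ = 0` to the south pole `σ = π`). [folklore] -/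
def fermiVec (σ β : ℝ) : EuclideanSpace ℝ (Fin 3) :=
  WithLp.toLp 2 ![cos β * sin σ, sin β, cos β * cos σ]

/-- Coordinates of `Y`. [folklore] -/
@[simp] theorem fermiVec_apply_zero (σ β : ℝ) : fermiVec σ β 0 = cos β * sin σ := rfl

/-- Coordinates of `Y`. [folklore] -/
@[simp] theorem fermiVec_apply_one (σ β : ℝ) : fermiVec σ β 1 = sin β := rfl

/-- Coordinates of `Y`. [folklore] -/
@[simp] theorem fermiVec_apply_two (σ β : ℝ) : fermiVec σ β 2 = cos β * cos σ := rfl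

/-- `Y` is a unit vector. [folklore] -/
theorem norm_fermiVec (σ β : ℝ) : ‖fermiVec σ β‖ = 1 := by
  rw [EuclideanSpace.norm_eq, Real.sqrt_eq_one, Fin.sum_univ_three]
  simp only [fermiVec_apply_zero, fermiVec_apply_one, fermiVec_apply_two, Real.norm_eq_abs,
    sq_abs]
  linear_combination cos β ^ 2 * sin_sq_add_cos_sq σ + sin_sq_add_cos_sq β

/-- **The spherical point `Y(σ, β) ∈ S²`.** [folklore] -/
def fermi (σ β : ℝ) : sphere (0 : EuclideanSpace ℝ (Fin 3)) 1 :=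
  ⟨fermiVec σ β, by rw [mem_sphere_zero_iff_norm, norm_fermiVec]⟩

/-- Underlying vector of `fermi`. [folklore] -/
@[simp] theorem coe_fermi (σ β : ℝ) :
    (fermi σ β : EuclideanSpace ℝ (Fin 3)) = fermiVec σ β := rfl

/-- `Y` is smooth into `ℝ³`. [folklore] -/
theorem contDiff_fermiVec : ContDiff ℝ ∞ fun p : ℝ × ℝ => fermiVec p.1 p.2 := by
  unfold fermiVec
  apply PiLp.contDiff_toLp.comp
  rw [contDiff_pi]
  intro i
  fin_cases i <;> simp <;> fun_prop

/-- `Y` is smooth into the sphere. [folklore] -/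
theorem contMDiff_fermi : ContMDiff 𝓘(ℝ, ℝ × ℝ) (𝓡 2) ∞ fun p : ℝ × ℝ => fermi p.1 p.2 := by
  haveI := Fact.mk (@finrank_euclideanSpace_fin ℝ _ (2 + 1))
  have h : ContMDiff 𝓘(ℝ, ℝ × ℝ) 𝓘(ℝ, EuclideanSpace ℝ (Fin 3)) ∞
      fun p : ℝ × ℝ => (fermi p.1 p.2 : EuclideanSpace ℝ (Fin 3)) := contDiff_fermiVec.contMDiff
  exact h.codRestrict_sphere fun p => (fermi p.1 p.2).2

/-- **The mirror** `(x₀, x₁, x₂) ↦ (x₀, x₁, -x₂)` of `S²` (swaps the poles). [folklore] -/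
def mirrorS2 (p : sphere (0 : EuclideanSpace ℝ (Fin 3)) 1) : sphere (0 : EuclideanSpace ℝ (Fin 3)) 1 :=
  ⟨WithLp.toLp 2 ![(p : EuclideanSpace ℝ (Fin 3)) 0, (p : EuclideanSpace ℝ (Fin 3)) 1,
      -(p : EuclideanSpace ℝ (Fin 3)) 2], by
    have hp := norm_eq_of_mem_sphere p
    rw [EuclideanSpace.norm_eq, Real.sqrt_eq_one, Fin.sum_univ_three] at hp
    rw [mem_sphere_zero_iff_norm, EuclideanSpace.norm_eq, Real.sqrt_eq_one, Fin.sum_univ_three]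
    simpa using hp⟩

/-- Coordinates of the mirror. [folklore] -/
@[simp] theorem mirrorS2_apply_zero (p : sphere (0 : EuclideanSpace ℝ (Fin 3)) 1) :
    (mirrorS2 p : EuclideanSpace ℝ (Fin 3)) 0 = (p : EuclideanSpace ℝ (Fin 3)) 0 := rfl

/-- Coordinates of the mirror. [folklore] -/
@[simp] theorem mirrorS2_apply_one (p : sphere (0 : EuclideanSpace ℝ (Fin 3)) 1) :
    (mirrorS2 p : EuclideanSpace ℝ (Fin 3)) 1 = (p : EuclideanSpace ℝ (Fin 3)) 1 := rfl

/-- Coordinates of the mirror. [folklore] -/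
@[simp] theorem mirrorS2_apply_two (p : sphere (0 : EuclideanSpace ℝ (Fin 3)) 1) :
    (mirrorS2 p : EuclideanSpace ℝ (Fin 3)) 2 = -(p : EuclideanSpace ℝ (Fin 3)) 2 := rfl

/-- The mirror is an involution. [folklore] -/
@[simp] theorem mirrorS2_mirrorS2 (p : sphere (0 : EuclideanSpace ℝ (Fin 3)) 1) :
    mirrorS2 (mirrorS2 p) = p := by
  apply Subtype.ext; ext i; fin_cases i <;> simp

/-- `Y(π - σ, β)` is the mirror image of `Y(σ, β)`. [folklore] -/
theorem fermi_pi_sub (σ β : ℝ) : fermi (π - σ) β = mirrorS2 (fermi σ β) := by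
  apply Subtype.ext; ext i
  fin_cases i <;> simp [sin_pi_sub, cos_pi_sub]

/-! ### The handle map -/

/-- The meridian angle `σ̃ = (X'' + 1) π/2` of the bent strip point `(X'', Y'') = Ψ⁻¹(s, a)`
(`= α` at the north end, `= π - α` at the south end, where `a = -(2/π) α`). [folklore] -/
def sigmaT (s a : ℝ) : ℝ := ((bentStrip (s, a)).1 + 1) * (π / 2)

/-- The radius `r = 49/50 + Y''` (`= 49/50 + tan (π s)` at the north end). [folklore] -/
def rad (s a : ℝ) : ℝ := 49 / 50 + (bentStrip (s, a)).2

/-- The transverse strip parameter `a = -(2/π) α(k(s), ζ)` of a handle point. [folklore] -/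
def aOf (s : ℝ) (ζ : ℂ) : ℝ := -(2 / π) * alphaOf (kfun s) ζ

/-- The plane point `r e^{ic} ∈ ℝ²`. [folklore] -/
def wOf (r c : ℝ) : EuclideanSpace ℝ (Fin 2) := IwasePolar.toE (↑r * Complex.exp (↑c * Complex.I))

/-- **The handle map** `h(s, ζ, c) = (Y(σ̃, β), r e^{ic})` with `β = arcsin (k Im ζ)`,
`α = arcsin (k Re ζ / cos β)`, `(X'', Y'') = Ψ⁻¹(s, -(2/π) α)`, `σ̃ = (X'' + 1)π/2`,
`r = 49/50 + Y''`, `k = k(s)`: at the two ends it is *exactly* the rotationally equivariant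
chart `(s, ζ, c) ↦ ((k ζ, ±√(1 - k²|ζ|²)), (49/50 + tan (π s)) e^{ic})` (`handleMap_coe_fst_of_le`),
in the middle it carries the slices `s = const` over the top of the arch from pole to pole.
[folklore] -/
def handleMap (u : ℝ × ℂ × ℝ) : sphere (0 : EuclideanSpace ℝ (Fin 3)) 1 × EuclideanSpace ℝ (Fin 2) :=
  (fermi (sigmaT u.1 (aOf u.1 u.2.1)) (betaOf (kfun u.1) u.2.1), wOf (rad u.1 (aOf u.1 u.2.1)) u.2.2)

/-- The working range: `k(s)² ‖ζ‖² ≤ 1/5` for `‖ζ‖ ≤ 5/2`. [folklore] -/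
theorem kfun_sq_mul_le (s : ℝ) {ζ : ℂ} (hζ : ‖ζ‖ ≤ 5 / 2) : kfun s ^ 2 * ‖ζ‖ ^ 2 ≤ 1 / 5 := by
  rw [kfun_sq]
  have := (Kfun_mem s).2
  have h2 : ‖ζ‖ ^ 2 ≤ 25 / 4 := by nlinarith [norm_nonneg ζ]
  nlinarith [(Kfun_mem s).1, sq_nonneg ‖ζ‖]

/-- `|a| ≤ 3/10` in the working range. [folklore] -/
theorem abs_aOf_le (s : ℝ) {ζ : ℂ} (hζ : ‖ζ‖ ≤ 5 / 2) : |aOf s ζ| ≤ 3 / 10 := by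
  have hπ : 3.14 < π := pi_gt_d2
  have hα := abs_alphaOf_le (kfun_sq_mul_le s hζ)
  rw [aOf, abs_mul, abs_neg, abs_div, abs_two, abs_of_pos pi_pos, div_mul_eq_mul_div,
    div_le_iff₀ pi_pos]
  nlinarith

/-- `-1 < a` in the working range. [folklore] -/
theorem neg_one_lt_aOf (s : ℝ) {ζ : ℂ} (hζ : ‖ζ‖ ≤ 5 / 2) : -1 < aOf s ζ := by
  have := (abs_le.1 (abs_aOf_le s hζ)).1; linarith

/-- `a` is mirror-symmetric in `s`. [folklore] -/
theorem aOf_one_sub (s : ℝ) (ζ : ℂ) : aOf (1 - s) ζ = aOf s ζ := by rw [aOf, aOf, kfun_one_sub]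

/-- North end: `σ̃ = -(π/2) a`. [folklore] -/
theorem sigmaT_eq_of_le {s a : ℝ} (hs0 : 0 ≤ s) (hs : s ≤ 1 / 10) (ha : |a| ≤ 3 / 10) :
    sigmaT s a = -(π / 2) * a := by
  rw [sigmaT, bentStrip_eq_of_le hs0 hs ha]; ring

/-- North end: `r = 49/50 + tan (π s)`. [folklore] -/
theorem rad_eq_of_le {s a : ℝ} (hs0 : 0 ≤ s) (hs : s ≤ 1 / 10) (ha : |a| ≤ 3 / 10) :
    rad s a = 49 / 50 + tan (π * s) := by
  rw [rad, bentStrip_eq_of_le hs0 hs ha]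

/-- South end: `σ̃ = π + (π/2) a`. [folklore] -/
theorem sigmaT_eq_of_ge {s a : ℝ} (hs : 9 / 10 ≤ s) (hs1 : s ≤ 1) (ha : |a| ≤ 3 / 10) :
    sigmaT s a = π + π / 2 * a := by
  rw [sigmaT, bentStrip_eq_of_ge hs hs1 ha]; ring

/-- South end: `r = 49/50 + tan (π (1 - s))`. [folklore] -/
theorem rad_eq_of_ge {s a : ℝ} (hs : 9 / 10 ≤ s) (hs1 : s ≤ 1) (ha : |a| ≤ 3 / 10) :
    rad s a = 49 / 50 + tan (π * (1 - s)) := by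
  rw [rad, bentStrip_eq_of_ge hs hs1 ha]

/-- Mirror symmetry of `σ̃`: `σ̃(1 - s) = π - σ̃(s)`. [folklore] -/
theorem sigmaT_one_sub (s a : ℝ) : sigmaT (1 - s) a = π - sigmaT s a := by
  rw [sigmaT, sigmaT, bentStrip_one_sub]; ring

/-- Mirror symmetry of `r`. [folklore] -/
theorem rad_one_sub (s a : ℝ) : rad (1 - s) a = rad s a := by
  rw [rad, rad, bentStrip_one_sub]

/-- North end: `σ̃ = α`. [folklore] -/
theorem sigmaT_aOf_of_le {s : ℝ} (hs0 : 0 ≤ s) (hs : s ≤ 1 / 10) {ζ : ℂ} (hζ : ‖ζ‖ ≤ 5 / 2) :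
    sigmaT s (aOf s ζ) = alphaOf (kfun s) ζ := by
  rw [sigmaT_eq_of_le hs0 hs (abs_aOf_le s hζ), aOf]
  field_simp

/-- **The handle map is mirror-symmetric**: `h(1 - s, ζ, c)` is the mirror image of
`h(s, ζ, c)`. [folklore] -/
theorem handleMap_one_sub (s : ℝ) (ζ : ℂ) (c : ℝ) :
    handleMap (1 - s, ζ, c) = (mirrorS2 (handleMap (s, ζ, c)).1, (handleMap (s, ζ, c)).2) := by
  simp only [handleMap, aOf_one_sub, sigmaT_one_sub, rad_one_sub, kfun_one_sub, fermi_pi_sub]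

/-- **North end normal form of the spherical component**: the coordinates of `h(s, ζ, c).1` are
`(k Re ζ, k Im ζ, √(1 - k²‖ζ‖²))`. [folklore] -/
theorem handleMap_coe_fst_of_le {s : ℝ} (hs0 : 0 ≤ s) (hs : s ≤ 1 / 10) {ζ : ℂ}
    (hζ : ‖ζ‖ ≤ 5 / 2) (c : ℝ) :
    ((handleMap (s, ζ, c)).1 : EuclideanSpace ℝ (Fin 3)) = WithLp.toLp 2
      ![kfun s * ζ.re, kfun s * ζ.im, Real.sqrt (1 - kfun s ^ 2 * ‖ζ‖ ^ 2)] := by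
  have h := kfun_sq_mul_le s hζ
  simp only [handleMap, coe_fermi, sigmaT_aOf_of_le hs0 hs hζ]
  ext i
  fin_cases i
  · simp [cos_betaOf, cb_mul_sin_alphaOf h]
  · simp [sin_betaOf h]
  · simp [cos_betaOf, cb_mul_cos_alphaOf h]

/-- North end: the second component is `(49/50 + tan (π s)) e^{ic}`. [folklore] -/
theorem handleMap_snd_of_le {s : ℝ} (hs0 : 0 ≤ s) (hs : s ≤ 1 / 10) {ζ : ℂ}
    (hζ : ‖ζ‖ ≤ 5 / 2) (c : ℝ) :
    (handleMap (s, ζ, c)).2 = wOf (49 / 50 + tan (π * s)) c := by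
  simp only [handleMap, rad_eq_of_le hs0 hs (abs_aOf_le s hζ)]

/-- North end: the equatorial coordinate is `y = k ζ`. [folklore] -/
theorem ycoord_handleMap_of_le {s : ℝ} (hs0 : 0 ≤ s) (hs : s ≤ 1 / 10) {ζ : ℂ}
    (hζ : ‖ζ‖ ≤ 5 / 2) (c : ℝ) :
    IwasePolar.ycoord (handleMap (s, ζ, c)).1 = ↑(kfun s) * ζ := by
  rw [IwasePolar.ycoord, handleMap_coe_fst_of_le hs0 hs hζ]
  apply Complex.ext <;> simp

/-- North end: `x = k² ‖ζ‖²`. [folklore] -/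
theorem xsq_handleMap_of_le {s : ℝ} (hs0 : 0 ≤ s) (hs : s ≤ 1 / 10) {ζ : ℂ}
    (hζ : ‖ζ‖ ≤ 5 / 2) (c : ℝ) :
    IwasePolar.xsq (handleMap (s, ζ, c)).1 = kfun s ^ 2 * ‖ζ‖ ^ 2 := by
  rw [IwasePolar.xsq, ycoord_handleMap_of_le hs0 hs hζ, norm_mul, Complex.norm_real,
    Real.norm_of_nonneg (kfun_pos s).le]
  ring

/-- North end: the polar coordinate `x₂ = √(1 - k²‖ζ‖²) > 0`. [folklore] -/
theorem handleMap_fst_apply_two_of_le {s : ℝ} (hs0 : 0 ≤ s) (hs : s ≤ 1 / 10) {ζ : ℂ}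
    (hζ : ‖ζ‖ ≤ 5 / 2) (c : ℝ) :
    ((handleMap (s, ζ, c)).1 : EuclideanSpace ℝ (Fin 3)) 2 = Real.sqrt (1 - kfun s ^ 2 * ‖ζ‖ ^ 2) := by
  rw [handleMap_coe_fst_of_le hs0 hs hζ]; simp

/-- **Equivariance at the north end**: multiplying `ζ` by a unit complex number rotates the
spherical component about the polar axis and leaves the plane component unchanged. [folklore] -/
theorem handleMap_mul_of_le {s : ℝ} (hs0 : 0 ≤ s) (hs : s ≤ 1 / 10) {ζ υ : ℂ}
    (hζ : ‖ζ‖ ≤ 5 / 2) (hυ : ‖υ‖ = 1) (c : ℝ) :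
    handleMap (s, υ * ζ, c) =
      (rotateSphereTwo (IwasePolar.circleOf υ) (handleMap (s, ζ, c)).1, (handleMap (s, ζ, c)).2) := by
  have hζ' : ‖υ * ζ‖ ≤ 5 / 2 := by rwa [norm_mul, hυ, one_mul]
  have hn : ‖υ * ζ‖ = ‖ζ‖ := by rw [norm_mul, hυ, one_mul]
  refine Prod.ext ?_ ?_
  · apply Subtype.ext
    rw [handleMap_coe_fst_of_le hs0 hs hζ']
    ext i
    fin_cases i
    · simp [handleMap_coe_fst_of_le hs0 hs hζ, IwasePolar.coe_circleOf hυ]; ring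
    · simp [handleMap_coe_fst_of_le hs0 hs hζ, IwasePolar.coe_circleOf hυ]; ring
    · simp [handleMap_coe_fst_of_le hs0 hs hζ, hυ]
  · simp only [handleMap_snd_of_le hs0 hs hζ', handleMap_snd_of_le hs0 hs hζ]

/-! ### The explicit inverse of the handle map -/

/-- `toC (wOf r c) = r e^{ic}`. [folklore] -/
@[simp] theorem toC_wOf (r c : ℝ) : toC (wOf r c) = ↑r * Complex.exp (↑c * Complex.I) := by
  rw [wOf, IwasePolar.toC_toE]

/-- `‖wOf r c‖ = r` for `r ≥ 0`. [folklore] -/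
theorem norm_wOf {r : ℝ} (hr : 0 ≤ r) (c : ℝ) : ‖wOf r c‖ = r := by
  rw [← norm_toC, toC_wOf, norm_mul, Complex.norm_real, Real.norm_of_nonneg hr,
    Complex.norm_exp_ofReal_mul_I, mul_one]

/-- `arg (wOf r c) = c` for `r > 0`, `c ∈ (-π, π]`. [folklore] -/
theorem arg_toC_wOf {r c : ℝ} (hr : 0 < r) (hc : c ∈ Ioc (-π) π) :
    Complex.arg (toC (wOf r c)) = c := by
  rw [toC_wOf, Complex.exp_mul_I]
  exact Complex.arg_mul_cos_add_sin_mul_I hr hc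

/-- `wOf ‖w‖ (arg w) = w`. [folklore] -/
theorem wOf_norm_arg (w : EuclideanSpace ℝ (Fin 2)) : wOf ‖w‖ (Complex.arg (toC w)) = w := by
  rw [wOf, ← norm_toC, Complex.norm_mul_exp_arg_mul_I, IwasePolar.toE_toC]

/-- The complex number `x₀ - i x₂` attached to a point of the sphere (its argument is
`σ̃ - π/2` on the meridian arch). [folklore] -/
def zP (P : sphere (0 : EuclideanSpace ℝ (Fin 3)) 1) : ℂ :=
  ⟨(P : EuclideanSpace ℝ (Fin 3)) 0, -(P : EuclideanSpace ℝ (Fin 3)) 2⟩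

/-- Real part of `zP`. [folklore] -/
@[simp] theorem zP_re (P : sphere (0 : EuclideanSpace ℝ (Fin 3)) 1) :
    (zP P).re = (P : EuclideanSpace ℝ (Fin 3)) 0 := rfl

/-- Imaginary part of `zP`. [folklore] -/
@[simp] theorem zP_im (P : sphere (0 : EuclideanSpace ℝ (Fin 3)) 1) :
    (zP P).im = -(P : EuclideanSpace ℝ (Fin 3)) 2 := rfl

/-- The coordinates of a point of the unit sphere satisfy `x₀² + x₁² + x₂² = 1`. [folklore] -/
theorem sphere_coord_sq_sum (P : sphere (0 : EuclideanSpace ℝ (Fin 3)) 1) :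
    (P : EuclideanSpace ℝ (Fin 3)) 0 ^ 2 + (P : EuclideanSpace ℝ (Fin 3)) 1 ^ 2 +
      (P : EuclideanSpace ℝ (Fin 3)) 2 ^ 2 = 1 := by
  have hp := norm_eq_of_mem_sphere P
  rw [EuclideanSpace.norm_eq, Real.sqrt_eq_one, Fin.sum_univ_three] at hp
  simpa only [Real.norm_eq_abs, sq_abs] using hp

/-- `‖zP P‖ = √(1 - x₁²)`. [folklore] -/
theorem norm_zP (P : sphere (0 : EuclideanSpace ℝ (Fin 3)) 1) :
    ‖zP P‖ = Real.sqrt (1 - (P : EuclideanSpace ℝ (Fin 3)) 1 ^ 2) := by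
  rw [Complex.norm_eq_sqrt_sq_add_sq, zP_re, zP_im]
  congr 1
  linear_combination sphere_coord_sq_sum P

/-- **The meridian angle of a point of the sphere**, `σ̃(P) = arg (x₀ - i x₂) + π/2`. [folklore] -/
def sigmaOf (P : sphere (0 : EuclideanSpace ℝ (Fin 3)) 1) : ℝ := Complex.arg (zP P) + π / 2

/-- `zP` of the spherical point `Y(σ, β)`. [folklore] -/
theorem zP_fermi (σ β : ℝ) : zP (fermi σ β) =
    ↑(cos β) * (Complex.cos ↑(σ - π / 2) + Complex.sin ↑(σ - π / 2) * Complex.I) := by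
  rw [← Complex.ofReal_cos, ← Complex.ofReal_sin, cos_sub_pi_div_two, sin_sub_pi_div_two]
  apply Complex.ext <;>
    simp only [zP_re, zP_im, coe_fermi, fermiVec_apply_zero, fermiVec_apply_two,
      Complex.re_ofReal_mul, Complex.im_ofReal_mul, Complex.add_re, Complex.add_im,
      Complex.ofReal_re, Complex.ofReal_im, Complex.mul_I_re, Complex.mul_I_im] <;> ring

/-- The meridian angle of `Y(σ, β)` is `σ` (for `cos β > 0`, `σ - π/2 ∈ (-π, π]`). [folklore] -/
theorem sigmaOf_fermi {σ β : ℝ} (hβ : 0 < cos β) (hσ : σ - π / 2 ∈ Ioc (-π) π) :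
    sigmaOf (fermi σ β) = σ := by
  rw [sigmaOf, zP_fermi, Complex.arg_mul_cos_add_sin_mul_I hβ hσ]; ring

/-- The horizontal factor is `1` far from the columns (`Y² ≥ 16/25`). [folklore] -/
theorem nfac_eq_one_of_le {Y : ℝ} (h : 16 / 25 ≤ Y ^ 2) : nfac Y = 1 := by
  rw [nfac, lam₂, smoothTransition.one_of_one_le ((one_le_div (by norm_num)).2 (by linarith))]
  ring

/-- `n ≤ 13/10`. [folklore] -/
theorem nfac_le (Y : ℝ) : nfac Y ≤ 13 / 10 := by
  by_cases h : 16 / 25 ≤ Y ^ 2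
  · rw [nfac_eq_one_of_le h]; norm_num
  · push Not at h
    have hs : Real.sqrt (1 + Y ^ 2) ≤ 13 / 10 := by
      rw [show (13 / 10 : ℝ) = Real.sqrt ((13 / 10) ^ 2) by rw [Real.sqrt_sq]; norm_num]
      exact Real.sqrt_le_sqrt (by nlinarith)
    obtain ⟨h0, h1⟩ := lam₂_mem Y
    unfold nfac
    nlinarith

/-- `|X''| ≤ 17/10` on the strip `|a| ≤ 3/10` (all `s`). [folklore] -/
theorem abs_bentStrip_fst_le (s : ℝ) {a : ℝ} (ha : |a| ≤ 3 / 10) :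
    |(bentStrip (s, a)).1| ≤ 17 / 10 := by
  simp only [bentStrip, hScale, vScale, polarMap]
  rw [abs_mul]
  have h1 : |nfac (mfac (-(1 + a) * cos (π * s)) * ((1 + a) * sin (π * s)))| ≤ 13 / 10 := by
    rw [abs_of_pos (nfac_pos _)]; exact nfac_le _
  have h2 : |-(1 + a) * cos (π * s)| ≤ 13 / 10 := by
    obtain ⟨ha1, ha2⟩ := abs_le.1 ha
    rw [abs_mul, abs_neg, abs_of_pos (by linarith : (0 : ℝ) < 1 + a)]
    nlinarith [abs_cos_le_one (π * s), abs_nonneg (cos (π * s))]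
  nlinarith [abs_nonneg (nfac (mfac (-(1 + a) * cos (π * s)) * ((1 + a) * sin (π * s)))),
    abs_nonneg (-(1 + a) * cos (π * s))]

/-- `σ̃ - π/2 = X'' π/2 ∈ (-π, π]`. [folklore] -/
theorem sigmaT_sub_mem (s : ℝ) {a : ℝ} (ha : |a| ≤ 3 / 10) : sigmaT s a - π / 2 ∈ Ioc (-π) π := by
  obtain ⟨h1, h2⟩ := abs_le.1 (abs_bentStrip_fst_le s ha)
  rw [sigmaT]
  constructor <;> nlinarith [pi_pos]

/-- `r > 0` (indeed `r ≥ 49/50`) on the strip. [folklore] -/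
theorem rad_pos {s a : ℝ} (hs : s ∈ Icc (0 : ℝ) 1) (ha : -1 < a) : 0 < rad s a := by
  have := bentStrip_snd_nonneg hs ha; rw [rad]; linarith

/-- `49/50 ≤ r` on the strip. [folklore] -/
theorem le_rad {s a : ℝ} (hs : s ∈ Icc (0 : ℝ) 1) (ha : -1 < a) : 49 / 50 ≤ rad s a := by
  have := bentStrip_snd_nonneg hs ha; rw [rad]; linarith

/-- **The meridian angle of a handle point is `σ̃`.** [folklore] -/
theorem sigmaOf_handleMap (s : ℝ) {ζ : ℂ} (hζ : ‖ζ‖ ≤ 5 / 2) (c : ℝ) :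
    sigmaOf (handleMap (s, ζ, c)).1 = sigmaT s (aOf s ζ) :=
  sigmaOf_fermi (by rw [cos_betaOf]; exact cbOf_pos (kfun_sq_mul_le s hζ))
    (sigmaT_sub_mem s (abs_aOf_le s hζ))

/-- **The radius of a handle point is `r`.** [folklore] -/
theorem norm_handleMap_snd {s : ℝ} (hs : s ∈ Icc (0 : ℝ) 1) {ζ : ℂ} (hζ : ‖ζ‖ ≤ 5 / 2) (c : ℝ) :
    ‖(handleMap (s, ζ, c)).2‖ = rad s (aOf s ζ) :=
  norm_wOf (rad_pos hs (neg_one_lt_aOf s hζ)).le c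

/-- The planar data `(X'', Y'') = (2σ̃/π - 1, ‖w‖ - 49/50)` of a point of `S² × ℝ²`. [folklore] -/
def planarOf (q : sphere (0 : EuclideanSpace ℝ (Fin 3)) 1 × EuclideanSpace ℝ (Fin 2)) : ℝ × ℝ :=
  (2 * sigmaOf q.1 / π - 1, ‖q.2‖ - 49 / 50)

/-- The strip data `(s, a) = Ψ(X'', Y'')`. [folklore] -/
def saOf (q : sphere (0 : EuclideanSpace ℝ (Fin 3)) 1 × EuclideanSpace ℝ (Fin 2)) : ℝ × ℝ :=
  bentStripInv (planarOf q)

/-- The slice coordinate `ζ = (sin α cos β + i sin β)/k(s)` recovered from a point, where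
`α = -(π/2) a`, `sin β = x₁`, `cos β = √(1 - x₁²)`. [folklore] -/
def zetaOf (q : sphere (0 : EuclideanSpace ℝ (Fin 3)) 1 × EuclideanSpace ℝ (Fin 2)) : ℂ :=
  ⟨sin (-(π / 2) * (saOf q).2) * Real.sqrt (1 - (q.1 : EuclideanSpace ℝ (Fin 3)) 1 ^ 2) /
      kfun (saOf q).1,
    (q.1 : EuclideanSpace ℝ (Fin 3)) 1 / kfun (saOf q).1⟩

/-- **The explicit inverse of the handle map**, `h⁻¹(P, w) = (s, ζ, arg w)`. [folklore] -/
def handleInv (q : sphere (0 : EuclideanSpace ℝ (Fin 3)) 1 × EuclideanSpace ℝ (Fin 2)) :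
    ℝ × ℂ × ℝ :=
  ((saOf q).1, zetaOf q, Complex.arg (toC q.2))

/-- Planar data of a handle point. [folklore] -/
theorem planarOf_handleMap {s : ℝ} (hs : s ∈ Icc (0 : ℝ) 1) {ζ : ℂ} (hζ : ‖ζ‖ ≤ 5 / 2) (c : ℝ) :
    planarOf (handleMap (s, ζ, c)) = bentStrip (s, aOf s ζ) := by
  rw [planarOf, sigmaOf_handleMap s hζ, norm_handleMap_snd hs hζ, sigmaT, rad]
  refine Prod.ext ?_ ?_
  · show 2 * (((bentStrip (s, aOf s ζ)).1 + 1) * (π / 2)) / π - 1 = (bentStrip (s, aOf s ζ)).1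
    field_simp
    ring
  · show 49 / 50 + (bentStrip (s, aOf s ζ)).2 - 49 / 50 = (bentStrip (s, aOf s ζ)).2
    ring

/-- Strip data of a handle point. [folklore] -/
theorem saOf_handleMap {s : ℝ} (hs : s ∈ Icc (0 : ℝ) 1) {ζ : ℂ} (hζ : ‖ζ‖ ≤ 5 / 2) (c : ℝ) :
    saOf (handleMap (s, ζ, c)) = (s, aOf s ζ) := by
  rw [saOf, planarOf_handleMap hs hζ,
    bentStripInv_bentStrip ⟨by linarith [hs.1], by linarith [hs.2]⟩ (neg_one_lt_aOf s hζ)]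

/-- The `x₁`-coordinate of a handle point is `k Im ζ`. [folklore] -/
theorem handleMap_fst_apply_one (s : ℝ) {ζ : ℂ} (hζ : ‖ζ‖ ≤ 5 / 2) (c : ℝ) :
    ((handleMap (s, ζ, c)).1 : EuclideanSpace ℝ (Fin 3)) 1 = kfun s * ζ.im := by
  simp [handleMap, sin_betaOf (kfun_sq_mul_le s hζ)]

/-- Slice coordinate of a handle point. [folklore] -/
theorem zetaOf_handleMap {s : ℝ} (hs : s ∈ Icc (0 : ℝ) 1) {ζ : ℂ} (hζ : ‖ζ‖ ≤ 5 / 2) (c : ℝ) :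
    zetaOf (handleMap (s, ζ, c)) = ζ := by
  have hk := (kfun_pos s).ne'
  have h := kfun_sq_mul_le s hζ
  have hα : -(π / 2) * aOf s ζ = alphaOf (kfun s) ζ := by
    rw [aOf]; field_simp
  rw [zetaOf, saOf_handleMap hs hζ, handleMap_fst_apply_one s hζ]
  apply Complex.ext
  · simp only [hα]
    rw [show Real.sqrt (1 - (kfun s * ζ.im) ^ 2) = cbOf (kfun s) ζ from rfl, mul_comm,
      cb_mul_sin_alphaOf h]
    field_simp
  · simp only
    field_simp

/-- **`h⁻¹ ∘ h = id`** on `[0, 1] × {‖ζ‖ ≤ 5/2} × (-π, π]`. [folklore] -/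
theorem handleInv_handleMap {s : ℝ} (hs : s ∈ Icc (0 : ℝ) 1) {ζ : ℂ} (hζ : ‖ζ‖ ≤ 5 / 2) {c : ℝ}
    (hc : c ∈ Ioc (-π) π) : handleInv (handleMap (s, ζ, c)) = (s, ζ, c) := by
  rw [handleInv, saOf_handleMap hs hζ, zetaOf_handleMap hs hζ]
  simp only [handleMap, Prod.mk.injEq, true_and]
  exact arg_toC_wOf (rad_pos hs (neg_one_lt_aOf s hζ)) hc

/-- Hence the handle map is injective on `[0, 1] × {‖ζ‖ ≤ 5/2} × (-π, π]`. [folklore] -/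
theorem handleMap_injOn : InjOn handleMap
    {u : ℝ × ℂ × ℝ | u.1 ∈ Icc (0 : ℝ) 1 ∧ ‖u.2.1‖ ≤ 5 / 2 ∧ u.2.2 ∈ Ioc (-π) π} := by
  rintro ⟨s, ζ, c⟩ ⟨hs, hζ, hc⟩ ⟨s', ζ', c'⟩ ⟨hs', hζ', hc'⟩ h
  rw [← handleInv_handleMap hs hζ hc, ← handleInv_handleMap hs' hζ' hc', h]

/-- **`h ∘ h⁻¹ = id`** wherever `|x₁| < 1` and the recovered strip parameter satisfies `|a| ≤ 1`.
[folklore] -/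
theorem handleMap_handleInv {q : sphere (0 : EuclideanSpace ℝ (Fin 3)) 1 × EuclideanSpace ℝ (Fin 2)}
    (h1 : |(q.1 : EuclideanSpace ℝ (Fin 3)) 1| < 1) (ha : |(saOf q).2| ≤ 1) :
    handleMap (handleInv q) = q := by
  obtain ⟨P, w⟩ := q
  obtain ⟨ha1, ha2⟩ := abs_le.1 ha
  obtain ⟨h11, h12⟩ := abs_lt.1 h1
  set s := (saOf (P, w)).1 with hs_def
  set a := (saOf (P, w)).2 with ha_def
  have hk := (kfun_pos s).ne'
  have hρ2 : 0 < 1 - (P : EuclideanSpace ℝ (Fin 3)) 1 ^ 2 := by nlinarith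
  set ρ := Real.sqrt (1 - (P : EuclideanSpace ℝ (Fin 3)) 1 ^ 2) with hρ_def
  have hρ : 0 < ρ := Real.sqrt_pos.2 hρ2
  have hkim : kfun s * (zetaOf (P, w)).im = (P : EuclideanSpace ℝ (Fin 3)) 1 := by
    simp only [zetaOf, ← hs_def]; field_simp
  have hkre : kfun s * (zetaOf (P, w)).re = sin (-(π / 2) * a) * ρ := by
    simp only [zetaOf, ← hs_def, ← ha_def, ← hρ_def]; field_simp
  have hcb : cbOf (kfun s) (zetaOf (P, w)) = ρ := by rw [cbOf, hkim, ← hρ_def]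
  have hαmem : -(π / 2) * a ∈ Icc (-(π / 2)) (π / 2) := ⟨by nlinarith [pi_pos], by nlinarith [pi_pos]⟩
  have hα : alphaOf (kfun s) (zetaOf (P, w)) = -(π / 2) * a := by
    rw [alphaOf, hkre, hcb, mul_div_cancel_right₀ _ hρ.ne', arcsin_sin hαmem.1 hαmem.2]
  have haOf : aOf s (zetaOf (P, w)) = a := by
    rw [aOf, hα]; field_simp
  have hbs : bentStrip (s, a) = planarOf (P, w) := by
    rw [show (s, a) = saOf (P, w) from Prod.ext rfl rfl, saOf, bentStrip_bentStripInv]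
  have hσ : sigmaT s a = sigmaOf P := by
    rw [sigmaT, hbs]
    show (2 * sigmaOf P / π - 1 + 1) * (π / 2) = sigmaOf P
    field_simp
    ring
  have hr : rad s a = ‖w‖ := by
    rw [rad, hbs]
    show 49 / 50 + (‖w‖ - 49 / 50) = ‖w‖
    ring
  have hβ : betaOf (kfun s) (zetaOf (P, w)) = arcsin ((P : EuclideanSpace ℝ (Fin 3)) 1) := by
    rw [betaOf, hkim]
  have hz : ‖zP P‖ = ρ := norm_zP P
  have hz0 : zP P ≠ 0 := by rw [← norm_ne_zero_iff, hz]; exact hρ.ne'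
  change handleMap (s, zetaOf (P, w), Complex.arg (toC w)) = (P, w)
  simp only [handleMap, haOf, hσ, hr, hβ, wOf_norm_arg]
  refine Prod.ext ?_ rfl
  apply Subtype.ext
  ext i
  fin_cases i
  · simp only [coe_fermi, Fin.zero_eta, fermiVec_apply_zero, cos_arcsin, sigmaOf,
      sin_add_pi_div_two, Complex.cos_arg hz0, hz, zP_re, ← hρ_def]
    field_simp
  · simp only [coe_fermi, Fin.mk_one, fermiVec_apply_one, sin_arcsin h11.le h12.le]
  · simp only [coe_fermi, Fin.reduceFinMk, fermiVec_apply_two, cos_arcsin, sigmaOf,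
      cos_add_pi_div_two, Complex.sin_arg, hz, zP_im, ← hρ_def]
    field_simp

/-! ### Smoothness of the handle map -/

/-- `(r, c) ↦ r e^{ic}` is smooth. [folklore] -/
theorem contDiff_wOf : ContDiff ℝ ∞ fun p : ℝ × ℝ => wOf p.1 p.2 := by
  unfold wOf
  exact IwasePolar.contDiff_toE.comp ((Complex.ofRealCLM.contDiff.comp contDiff_fst).mul
    (Complex.contDiff_exp.comp ((Complex.ofRealCLM.contDiff.comp contDiff_snd).mul
      contDiff_const)))

/-- `|a| < 3/10` strictly, in the working range. [folklore] -/
theorem abs_aOf_lt (s : ℝ) {ζ : ℂ} (hζ : ‖ζ‖ ≤ 5 / 2) : |aOf s ζ| < 3 / 10 := by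
  have hπ : 3.14 < π := pi_gt_d2
  have hα := abs_alphaOf_le (kfun_sq_mul_le s hζ)
  rw [aOf, abs_mul, abs_neg, abs_div, abs_two, abs_of_pos pi_pos, div_mul_eq_mul_div,
    div_lt_iff₀ pi_pos]
  nlinarith

/-- The strip parameter `a(s, ζ)` is smooth in `(s, ζ)` on `‖ζ‖ < 5/2` (the arcsines stay inside
`(-1, 1)`). [folklore] -/
theorem contDiffAt_aOf {u : ℝ × ℂ} (hu : ‖u.2‖ < 5 / 2) :
    ContDiffAt ℝ ∞ (fun u : ℝ × ℂ => aOf u.1 u.2) u := by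
  obtain ⟨s, ζ⟩ := u
  have h := kfun_sq_mul_le s hu.le
  have hk : ContDiff ℝ ∞ fun u : ℝ × ℂ => kfun u.1 := contDiff_kfun.comp contDiff_fst
  have him : ContDiff ℝ ∞ fun u : ℝ × ℂ => kfun u.1 * u.2.im :=
    hk.mul (Complex.imCLM.contDiff.comp contDiff_snd)
  have hre : ContDiff ℝ ∞ fun u : ℝ × ℂ => kfun u.1 * u.2.re :=
    hk.mul (Complex.reCLM.contDiff.comp contDiff_snd)
  have hv2 : (kfun s * ζ.im) ^ 2 ≤ 1 / 5 := by nlinarith [sq_add_sq_eq (kfun s) ζ, sq_nonneg (kfun s * ζ.re)]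
  have hcbpos := cbOf_pos h
  have hcb : ContDiffAt ℝ ∞ (fun u : ℝ × ℂ => cbOf (kfun u.1) u.2) (s, ζ) := by
    unfold cbOf
    exact (contDiffAt_const.sub (him.contDiffAt.pow 2)).sqrt
      (by nlinarith : (0 : ℝ) < 1 - (kfun s * ζ.im) ^ 2).ne'
  have ht : ContDiffAt ℝ ∞ (fun u : ℝ × ℂ => kfun u.1 * u.2.re / cbOf (kfun u.1) u.2) (s, ζ) :=
    hre.contDiffAt.div hcb hcbpos.ne'
  have ht2 := div_sq_le h
  obtain ⟨ht3, ht4⟩ := abs_lt.1 (abs_lt_of_sq_lt_sq (show (kfun s * ζ.re / cbOf (kfun s) ζ) ^ 2 <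
    1 ^ 2 by linarith) zero_le_one)
  have harc : ContDiffAt ℝ ∞ Real.arcsin (kfun s * ζ.re / cbOf (kfun s) ζ) :=
    contDiffAt_arcsin ht3.ne' ht4.ne
  have hα := harc.comp (s, ζ) ht
  have hres := contDiffAt_const (c := -(2 / π)) |>.mul hα
  exact hres

/-- The latitude angle `β(k(s), ζ)` is smooth on `‖ζ‖ < 5/2`. [folklore] -/
theorem contDiffAt_betaOf {u : ℝ × ℂ} (hu : ‖u.2‖ < 5 / 2) :
    ContDiffAt ℝ ∞ (fun u : ℝ × ℂ => betaOf (kfun u.1) u.2) u := by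
  obtain ⟨s, ζ⟩ := u
  have h := kfun_sq_mul_le s hu.le
  have him : ContDiff ℝ ∞ fun u : ℝ × ℂ => kfun u.1 * u.2.im :=
    (contDiff_kfun.comp contDiff_fst).mul (Complex.imCLM.contDiff.comp contDiff_snd)
  have hv2 : (kfun s * ζ.im) ^ 2 < 1 ^ 2 := by
    nlinarith [sq_add_sq_eq (kfun s) ζ, sq_nonneg (kfun s * ζ.re)]
  obtain ⟨h3, h4⟩ := abs_lt.1 (abs_lt_of_sq_lt_sq hv2 zero_le_one)
  have harc : ContDiffAt ℝ ∞ Real.arcsin (kfun s * ζ.im) := contDiffAt_arcsin h3.ne' h4.ne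
  have hβ := harc.comp (s, ζ) him.contDiffAt
  exact hβ

/-- **The handle map is smooth** on `ℝ × {‖ζ‖ < 5/2} × ℝ`. [folklore] -/
theorem contMDiffAt_handleMap {u : ℝ × ℂ × ℝ} (hu : ‖u.2.1‖ < 5 / 2) :
    ContMDiffAt 𝓘(ℝ, ℝ × ℂ × ℝ) ((𝓡 2).prod 𝓘(ℝ, EuclideanSpace ℝ (Fin 2))) ∞ handleMap u := by
  -- the real parameters as smooth functions of `u` (built bottom-up, no expected types)
  have hsz : ContDiff ℝ ∞ fun u : ℝ × ℂ × ℝ => (u.1, u.2.1) :=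
    contDiff_fst.prodMk (contDiff_fst.comp contDiff_snd)
  have ha := (contDiffAt_aOf (u := (u.1, u.2.1)) hu).comp u hsz.contDiffAt
  have hβ := (contDiffAt_betaOf (u := (u.1, u.2.1)) hu).comp u hsz.contDiffAt
  have hbs := contDiff_bentStrip.contDiffAt.comp u (contDiffAt_fst.prodMk ha)
  have hX := contDiffAt_fst.comp u hbs
  have hY := contDiffAt_snd.comp u hbs
  have hσ := (hX.add (contDiffAt_const (c := (1 : ℝ)))).mul (contDiffAt_const (c := π / 2))
  have hr := (contDiffAt_const (c := (49 / 50 : ℝ))).add hY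
  have hc : ContDiffAt ℝ ∞ (fun u : ℝ × ℂ × ℝ => u.2.2) u := contDiffAt_snd.comp u contDiffAt_snd
  have hP := contMDiff_fermi.contMDiffAt.comp u (hσ.prodMk hβ).contMDiffAt
  have hw := (contDiff_wOf.contDiffAt.comp u (hr.prodMk hc)).contMDiffAt
  exact hP.prodMk hw

/-- The handle map is continuous at points with `‖ζ‖ < 5/2`. [folklore] -/
theorem continuousAt_handleMap {u : ℝ × ℂ × ℝ} (hu : ‖u.2.1‖ < 5 / 2) : ContinuousAt handleMap u :=
  (contMDiffAt_handleMap hu).continuousAt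

/-! ### Smoothness of the inverse -/

/-- The regularity conditions under which `h⁻¹` is smooth: `|x₁| < 1`, the meridian angle and
the polar angle of `w` are away from their cuts, and the planar data lie in the good region of
`Ψ`. [folklore] -/
def Good (q : sphere (0 : EuclideanSpace ℝ (Fin 3)) 1 × EuclideanSpace ℝ (Fin 2)) : Prop :=
  |(q.1 : EuclideanSpace ℝ (Fin 3)) 1| < 1 ∧ zP q.1 ∈ Complex.slitPlane ∧
    toC q.2 ∈ Complex.slitPlane ∧ (0 < (planarOf q).2 ∨ (planarOf q).1 ≠ 0)

/-- A coordinate of a point of the sphere is a smooth function. [folklore] -/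
theorem contMDiff_sphere_coord (i : Fin 3) :
    ContMDiff (𝓡 2) 𝓘(ℝ, ℝ) ∞ fun P : sphere (0 : EuclideanSpace ℝ (Fin 3)) 1 =>
      (P : EuclideanSpace ℝ (Fin 3)) i := by
  haveI := Fact.mk (@finrank_euclideanSpace_fin ℝ _ 3)
  have h : ContDiff ℝ ∞ fun v : EuclideanSpace ℝ (Fin 3) => v i :=
    contDiff_piLp_apply (p := 2) (i := i)
  exact h.comp_contMDiff contMDiff_coe_sphere

/-- `zP` is smooth on the sphere. [folklore] -/
theorem contMDiff_zP : ContMDiff (𝓡 2) 𝓘(ℝ, ℂ) ∞ zP := by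
  have : zP = fun P : sphere (0 : EuclideanSpace ℝ (Fin 3)) 1 =>
      Complex.equivRealProdCLM.symm ((P : EuclideanSpace ℝ (Fin 3)) 0,
        -(P : EuclideanSpace ℝ (Fin 3)) 2) := by
    funext P; apply Complex.ext <;> simp [zP]
  rw [this]
  exact Complex.equivRealProdCLM.symm.contDiff.comp_contMDiff
    ((contMDiff_sphere_coord 0).prodMk_space (contMDiff_sphere_coord 2).neg)

/-- The meridian angle is smooth where `zP` is off the cut. [folklore] -/
theorem contMDiffAt_sigmaOf {P : sphere (0 : EuclideanSpace ℝ (Fin 3)) 1}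
    (hP : zP P ∈ Complex.slitPlane) : ContMDiffAt (𝓡 2) 𝓘(ℝ, ℝ) ∞ sigmaOf P := by
  unfold sigmaOf
  exact ((contDiffAt_arg hP).contMDiffAt.comp P contMDiff_zP.contMDiffAt).add contMDiffAt_const

/-- The planar data are smooth where `zP` and `w` are off their cuts. [folklore] -/
theorem contMDiffAt_planarOf {q : sphere (0 : EuclideanSpace ℝ (Fin 3)) 1 × EuclideanSpace ℝ (Fin 2)}
    (hP : zP q.1 ∈ Complex.slitPlane) (hw : q.2 ≠ 0) :
    ContMDiffAt ((𝓡 2).prod 𝓘(ℝ, EuclideanSpace ℝ (Fin 2))) 𝓘(ℝ, ℝ × ℝ) ∞ planarOf q := by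
  have hG : ContDiff ℝ ∞ fun p : ℝ × ℝ => (2 * p.1 / π - 1, p.2 - 49 / 50) :=
    (((contDiff_const.mul contDiff_fst).div_const π).sub contDiff_const).prodMk
      (contDiff_snd.sub contDiff_const)
  have h1 : ContMDiffAt ((𝓡 2).prod 𝓘(ℝ, EuclideanSpace ℝ (Fin 2))) 𝓘(ℝ, ℝ) ∞
      (fun q : sphere (0 : EuclideanSpace ℝ (Fin 3)) 1 × EuclideanSpace ℝ (Fin 2) =>
        sigmaOf q.1) q :=
    (contMDiffAt_sigmaOf hP).comp q contMDiffAt_fst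
  have h2 : ContMDiffAt ((𝓡 2).prod 𝓘(ℝ, EuclideanSpace ℝ (Fin 2))) 𝓘(ℝ, ℝ) ∞
      (fun q : sphere (0 : EuclideanSpace ℝ (Fin 3)) 1 × EuclideanSpace ℝ (Fin 2) => ‖q.2‖) q :=
    (contDiffAt_norm ℝ hw).contMDiffAt.comp q contMDiffAt_snd
  exact hG.contDiffAt.contMDiffAt.comp q (h1.prodMk_space h2)

/-- The strip data are smooth under the regularity conditions. [folklore] -/
theorem contMDiffAt_saOf {q : sphere (0 : EuclideanSpace ℝ (Fin 3)) 1 × EuclideanSpace ℝ (Fin 2)}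
    (hq : Good q) : ContMDiffAt ((𝓡 2).prod 𝓘(ℝ, EuclideanSpace ℝ (Fin 2))) 𝓘(ℝ, ℝ × ℝ) ∞ saOf q := by
  obtain ⟨_, hP, hw, hgood⟩ := hq
  have hw0 : q.2 ≠ 0 := by
    intro h; apply Complex.slitPlane_ne_zero hw
    rw [← norm_eq_zero, norm_toC, h, norm_zero]
  unfold saOf
  exact (contDiffAt_bentStripInv hgood).contMDiffAt.comp q (contMDiffAt_planarOf hP hw0)

/-- The auxiliary real formula for `ζ`: `F(s, a, x₁) = (sin(-(π/2)a) √(1 - x₁²) + i x₁)/k(s)`.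
[folklore] -/
def zetaAux (v : ℝ × ℝ × ℝ) : ℂ :=
  ⟨sin (-(π / 2) * v.2.1) * Real.sqrt (1 - v.2.2 ^ 2) / kfun v.1, v.2.2 / kfun v.1⟩

/-- `zetaAux` is smooth where `|x₁| < 1`. [folklore] -/
theorem contDiffAt_zetaAux {v : ℝ × ℝ × ℝ} (hv : |v.2.2| < 1) : ContDiffAt ℝ ∞ zetaAux v := by
  obtain ⟨hv1, hv2⟩ := abs_lt.1 hv
  have hk : ContDiff ℝ ∞ fun v : ℝ × ℝ × ℝ => kfun v.1 := contDiff_kfun.comp contDiff_fst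
  have hk0 : kfun v.1 ≠ 0 := (kfun_pos v.1).ne'
  have hx : ContDiff ℝ ∞ fun v : ℝ × ℝ × ℝ => v.2.2 := contDiff_snd.comp contDiff_snd
  have ha : ContDiff ℝ ∞ fun v : ℝ × ℝ × ℝ => v.2.1 := contDiff_fst.comp contDiff_snd
  have hsq : ContDiffAt ℝ ∞ (fun v : ℝ × ℝ × ℝ => Real.sqrt (1 - v.2.2 ^ 2)) v :=
    (contDiffAt_const.sub (hx.contDiffAt.pow 2)).sqrt
      (by nlinarith : (0 : ℝ) < 1 - v.2.2 ^ 2).ne'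
  have hre : ContDiffAt ℝ ∞ (fun v : ℝ × ℝ × ℝ =>
      sin (-(π / 2) * v.2.1) * Real.sqrt (1 - v.2.2 ^ 2) / kfun v.1) v :=
    (((Real.contDiff_sin.comp (contDiff_const.mul ha)).contDiffAt.mul hsq).div hk.contDiffAt hk0)
  have him : ContDiffAt ℝ ∞ (fun v : ℝ × ℝ × ℝ => v.2.2 / kfun v.1) v :=
    hx.contDiffAt.div hk.contDiffAt hk0
  have : zetaAux = fun v => Complex.equivRealProdCLM.symm
      (sin (-(π / 2) * v.2.1) * Real.sqrt (1 - v.2.2 ^ 2) / kfun v.1, v.2.2 / kfun v.1) := by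
    funext v; apply Complex.ext <;> simp [zetaAux]
  rw [this]
  exact Complex.equivRealProdCLM.symm.contDiff.contDiffAt.comp v (hre.prodMk him)

/-- `zetaOf` factors through `zetaAux`. [folklore] -/
theorem zetaOf_eq (q : sphere (0 : EuclideanSpace ℝ (Fin 3)) 1 × EuclideanSpace ℝ (Fin 2)) :
    zetaOf q = zetaAux ((saOf q).1, (saOf q).2, (q.1 : EuclideanSpace ℝ (Fin 3)) 1) := rfl

/-- `ζ(q)` is smooth under the regularity conditions. [folklore] -/
theorem contMDiffAt_zetaOf {q : sphere (0 : EuclideanSpace ℝ (Fin 3)) 1 × EuclideanSpace ℝ (Fin 2)}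
    (hq : Good q) : ContMDiffAt ((𝓡 2).prod 𝓘(ℝ, EuclideanSpace ℝ (Fin 2))) 𝓘(ℝ, ℂ) ∞ zetaOf q := by
  have hsa := contMDiffAt_saOf hq
  have hx : ContMDiffAt ((𝓡 2).prod 𝓘(ℝ, EuclideanSpace ℝ (Fin 2))) 𝓘(ℝ, ℝ) ∞
      (fun q : sphere (0 : EuclideanSpace ℝ (Fin 3)) 1 × EuclideanSpace ℝ (Fin 2) =>
        (q.1 : EuclideanSpace ℝ (Fin 3)) 1) q :=
    (contMDiff_sphere_coord 1).contMDiffAt.comp q contMDiffAt_fst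
  have hv : ContMDiffAt ((𝓡 2).prod 𝓘(ℝ, EuclideanSpace ℝ (Fin 2))) 𝓘(ℝ, ℝ × ℝ × ℝ) ∞
      (fun q : sphere (0 : EuclideanSpace ℝ (Fin 3)) 1 × EuclideanSpace ℝ (Fin 2) =>
        ((saOf q).1, (saOf q).2, (q.1 : EuclideanSpace ℝ (Fin 3)) 1)) q :=
    (contDiff_fst.contMDiff.contMDiffAt.comp q hsa).prodMk_space
      ((contDiff_snd.contMDiff.contMDiffAt.comp q hsa).prodMk_space hx)
  simp only [show zetaOf = fun q => zetaAux ((saOf q).1, (saOf q).2,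
    (q.1 : EuclideanSpace ℝ (Fin 3)) 1) from funext zetaOf_eq]
  exact (contDiffAt_zetaAux hq.1).contMDiffAt.comp q hv

/-- **The inverse of the handle map is smooth under the regularity conditions.** [folklore] -/
theorem contMDiffAt_handleInv {q : sphere (0 : EuclideanSpace ℝ (Fin 3)) 1 × EuclideanSpace ℝ (Fin 2)}
    (hq : Good q) :
    ContMDiffAt ((𝓡 2).prod 𝓘(ℝ, EuclideanSpace ℝ (Fin 2))) 𝓘(ℝ, ℝ × ℂ × ℝ) ∞ handleInv q := by
  have hsa := contMDiffAt_saOf hq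
  have hc : ContMDiffAt ((𝓡 2).prod 𝓘(ℝ, EuclideanSpace ℝ (Fin 2))) 𝓘(ℝ, ℝ) ∞
      (fun q : sphere (0 : EuclideanSpace ℝ (Fin 3)) 1 × EuclideanSpace ℝ (Fin 2) =>
        Complex.arg (toC q.2)) q :=
    (contDiffAt_arg hq.2.2.1).contMDiffAt.comp q (contDiff_toC.contMDiff.contMDiffAt.comp q
      contMDiffAt_snd)
  exact (contDiff_fst.contMDiff.contMDiffAt.comp q hsa).prodMk_space
    ((contMDiffAt_zetaOf hq).prodMk_space hc)

/-- `h⁻¹` is continuous under the regularity conditions. [folklore] -/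
theorem continuousAt_handleInv {q : sphere (0 : EuclideanSpace ℝ (Fin 3)) 1 × EuclideanSpace ℝ (Fin 2)}
    (hq : Good q) : ContinuousAt handleInv q :=
  (contMDiffAt_handleInv hq).continuousAt

/-- The regularity conditions are open. [folklore] -/
theorem isOpen_good : IsOpen {q : sphere (0 : EuclideanSpace ℝ (Fin 3)) 1 × EuclideanSpace ℝ (Fin 2) |
    Good q} := by
  rw [isOpen_iff_mem_nhds]
  intro q hq
  obtain ⟨h1, hP, hw, hgood⟩ := hq
  have hw0 : q.2 ≠ 0 := by
    intro h; apply Complex.slitPlane_ne_zero hw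
    rw [← norm_eq_zero, norm_toC, h, norm_zero]
  have c1 : Continuous fun q : sphere (0 : EuclideanSpace ℝ (Fin 3)) 1 × EuclideanSpace ℝ (Fin 2) =>
      |(q.1 : EuclideanSpace ℝ (Fin 3)) 1| :=
    continuous_abs.comp (((contMDiff_sphere_coord 1).continuous).comp continuous_fst)
  have e1 : ∀ᶠ q' in 𝓝 q, |(q'.1 : EuclideanSpace ℝ (Fin 3)) 1| < 1 :=
    c1.continuousAt.eventually_lt continuousAt_const h1
  have e2 : ∀ᶠ q' : sphere (0 : EuclideanSpace ℝ (Fin 3)) 1 × EuclideanSpace ℝ (Fin 2) in 𝓝 q,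
      zP q'.1 ∈ Complex.slitPlane :=
    (contMDiff_zP.continuous.comp continuous_fst).continuousAt.preimage_mem_nhds
      (Complex.isOpen_slitPlane.mem_nhds hP)
  have e3 : ∀ᶠ q' : sphere (0 : EuclideanSpace ℝ (Fin 3)) 1 × EuclideanSpace ℝ (Fin 2) in 𝓝 q,
      toC q'.2 ∈ Complex.slitPlane :=
    (contDiff_toC.continuous.comp continuous_snd).continuousAt.preimage_mem_nhds
      (Complex.isOpen_slitPlane.mem_nhds hw)
  have ho : IsOpen {p : ℝ × ℝ | 0 < p.2 ∨ p.1 ≠ 0} :=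
    (isOpen_lt continuous_const continuous_snd).union (isOpen_ne_fun continuous_fst continuous_const)
  have e4 : ∀ᶠ q' : sphere (0 : EuclideanSpace ℝ (Fin 3)) 1 × EuclideanSpace ℝ (Fin 2) in 𝓝 q,
      0 < (planarOf q').2 ∨ (planarOf q').1 ≠ 0 :=
    (contMDiffAt_planarOf hP hw0).continuousAt.preimage_mem_nhds (ho.mem_nhds hgood)
  filter_upwards [e1, e2, e3, e4] with q' a1 a2 a3 a4
  exact ⟨a1, a2, a3, a4⟩

/-! ### The handle as an open set, and `h` as a bijection onto it -/

/-- **The parameter box of the handle** `U = (0, 1) × {‖ζ‖ < 23/10} × {|c| < 23/10}`. [folklore] -/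
def Ubox : Set (ℝ × ℂ × ℝ) := {u | u.1 ∈ Ioo (0 : ℝ) 1 ∧ ‖u.2.1‖ < 23 / 10 ∧ |u.2.2| < 23 / 10}

/-- The parameter box is open. [folklore] -/
theorem isOpen_Ubox : IsOpen Ubox := by
  refine (isOpen_Ioo.preimage continuous_fst).inter
    ((isOpen_lt (continuous_norm.comp (continuous_fst.comp continuous_snd)) continuous_const).inter
      (isOpen_lt (continuous_abs.comp (continuous_snd.comp continuous_snd)) continuous_const))

/-- **The handle** `H = h(U)`, described intrinsically: the regularity conditions hold, `h⁻¹`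
lands in the box, and the strip parameter is `< 3/10` in absolute value. [folklore] -/
def Hset : Set (sphere (0 : EuclideanSpace ℝ (Fin 3)) 1 × EuclideanSpace ℝ (Fin 2)) :=
  {q | Good q ∧ handleInv q ∈ Ubox ∧ |(saOf q).2| < 3 / 10}

/-- The handle is open. [folklore] -/
theorem isOpen_Hset : IsOpen Hset := by
  rw [isOpen_iff_mem_nhds]
  rintro q ⟨hg, hU, ha⟩
  have e1 : ∀ᶠ q' in 𝓝 q, Good q' := isOpen_good.mem_nhds hg
  have e2 : ∀ᶠ q' in 𝓝 q, handleInv q' ∈ Ubox :=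
    (continuousAt_handleInv hg).preimage_mem_nhds (isOpen_Ubox.mem_nhds hU)
  have e3 : ∀ᶠ q' in 𝓝 q, |(saOf q').2| < 3 / 10 :=
    (continuous_abs.continuousAt.comp (continuousAt_snd.comp
      (contMDiffAt_saOf hg).continuousAt)).eventually_lt continuousAt_const ha
  filter_upwards [e1, e2, e3] with q' a1 a2 a3
  exact ⟨a1, a2, a3⟩

/-- A box point has `s ∈ [0, 1]`, `‖ζ‖ ≤ 5/2`, `c ∈ (-π, π]`. [folklore] -/
theorem Ubox_aux {u : ℝ × ℂ × ℝ} (hu : u ∈ Ubox) :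
    u.1 ∈ Icc (0 : ℝ) 1 ∧ ‖u.2.1‖ ≤ 5 / 2 ∧ u.2.2 ∈ Ioc (-π) π := by
  obtain ⟨⟨h1, h2⟩, h3, h4⟩ := hu
  have hπ : 3 < π := pi_gt_three
  obtain ⟨h5, h6⟩ := abs_lt.1 h4
  exact ⟨⟨h1.le, h2.le⟩, by linarith, ⟨by linarith, by linarith⟩⟩

/-- **`h` maps the box into the handle.** [folklore] -/
theorem handleMap_mem_Hset {u : ℝ × ℂ × ℝ} (hu : u ∈ Ubox) : handleMap u ∈ Hset := by
  obtain ⟨s, ζ, c⟩ := u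
  obtain ⟨hs, hζ, hc⟩ := Ubox_aux hu
  have h := kfun_sq_mul_le s hζ
  have hinv : handleInv (handleMap (s, ζ, c)) = (s, ζ, c) := handleInv_handleMap hs hζ hc
  have hsa : saOf (handleMap (s, ζ, c)) = (s, aOf s ζ) := saOf_handleMap hs hζ c
  refine ⟨⟨?_, ?_, ?_, ?_⟩, by rw [hinv]; exact hu, by rw [hsa]; exact abs_aOf_lt s hζ⟩
  · -- `|x₁| = |k Im ζ| < 1`
    rw [handleMap_fst_apply_one s hζ]
    refine abs_lt_of_sq_lt_sq ?_ zero_le_one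
    nlinarith [sq_add_sq_eq (kfun s) ζ, sq_nonneg (kfun s * ζ.re)]
  · -- `zP` off the cut: its argument is `σ̃ - π/2 ∈ (-π, π)`
    have hmem := sigmaT_sub_mem s (abs_aOf_le s hζ)
    have hcb : 0 < cos (betaOf (kfun s) ζ) := by rw [cos_betaOf]; exact cbOf_pos h
    change zP (fermi (sigmaT s (aOf s ζ)) (betaOf (kfun s) ζ)) ∈ Complex.slitPlane
    rw [zP_fermi, Complex.mem_slitPlane_iff_arg, Complex.arg_mul_cos_add_sin_mul_I hcb hmem]
    refine ⟨?_, ?_⟩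
    · obtain ⟨h1, h2⟩ := abs_le.1 (abs_bentStrip_fst_le s (abs_aOf_le s hζ))
      intro heq
      rw [sigmaT] at heq
      nlinarith [pi_pos]
    · rw [← Complex.exp_mul_I]
      exact mul_ne_zero (Complex.ofReal_ne_zero.2 hcb.ne') (Complex.exp_ne_zero _)
  · -- `w = r e^{ic}` off the cut
    change toC (wOf (rad s (aOf s ζ)) c) ∈ Complex.slitPlane
    have hr := rad_pos hs (neg_one_lt_aOf s hζ)
    rw [Complex.mem_slitPlane_iff_arg, arg_toC_wOf hr hc]
    obtain ⟨h5, h6⟩ := abs_lt.1 hu.2.2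
    refine ⟨(by linarith [pi_gt_three] : c < π).ne, ?_⟩
    rw [toC_wOf]
    exact mul_ne_zero (Complex.ofReal_ne_zero.2 hr.ne') (Complex.exp_ne_zero _)
  · rw [planarOf_handleMap hs hζ]
    exact bentStrip_mem_good hs (neg_one_lt_aOf s hζ)

/-- **`h⁻¹` maps the handle into the box** (by definition). [folklore] -/
theorem handleInv_mem_Ubox {q : sphere (0 : EuclideanSpace ℝ (Fin 3)) 1 × EuclideanSpace ℝ (Fin 2)}
    (hq : q ∈ Hset) : handleInv q ∈ Ubox := hq.2.1

/-- **`h ∘ h⁻¹ = id` on the handle.** [folklore] -/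
theorem handleMap_handleInv_of_mem {q : sphere (0 : EuclideanSpace ℝ (Fin 3)) 1 × EuclideanSpace ℝ (Fin 2)}
    (hq : q ∈ Hset) : handleMap (handleInv q) = q :=
  handleMap_handleInv hq.1.1 (by linarith [hq.2.2, abs_nonneg (saOf q).2])

/-- **`h⁻¹ ∘ h = id` on the box.** [folklore] -/
theorem handleInv_handleMap_of_mem {u : ℝ × ℂ × ℝ} (hu : u ∈ Ubox) : handleInv (handleMap u) = u := by
  obtain ⟨hs, hζ, hc⟩ := Ubox_aux hu
  exact handleInv_handleMap hs hζ hc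

/-- **The handle is the image of the box.** [folklore] -/
theorem image_handleMap_Ubox : handleMap '' Ubox = Hset := by
  apply Subset.antisymm
  · rintro _ ⟨u, hu, rfl⟩; exact handleMap_mem_Hset hu
  · intro q hq; exact ⟨handleInv q, handleInv_mem_Ubox hq, handleMap_handleInv_of_mem hq⟩

/-- `h` restricts to a bijection from the box onto the handle. [folklore] -/
theorem bijOn_handleMap : BijOn handleMap Ubox Hset :=
  ⟨fun _ hu => handleMap_mem_Hset hu,
    fun _ hu _ hu' h => by rw [← handleInv_handleMap_of_mem hu, ← handleInv_handleMap_of_mem hu', h],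
    fun q hq => ⟨handleInv q, handleInv_mem_Ubox hq, handleMap_handleInv_of_mem hq⟩⟩

/-- The handle map is smooth at every box point. [folklore] -/
theorem contMDiffAt_handleMap_of_mem {u : ℝ × ℂ × ℝ} (hu : u ∈ Ubox) :
    ContMDiffAt 𝓘(ℝ, ℝ × ℂ × ℝ) ((𝓡 2).prod 𝓘(ℝ, EuclideanSpace ℝ (Fin 2))) ∞ handleMap u :=
  contMDiffAt_handleMap (by linarith [hu.2.1])

/-- The inverse is smooth at every handle point. [folklore] -/
theorem contMDiffAt_handleInv_of_mem {q : sphere (0 : EuclideanSpace ℝ (Fin 3)) 1 × EuclideanSpace ℝ (Fin 2)}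
    (hq : q ∈ Hset) :
    ContMDiffAt ((𝓡 2).prod 𝓘(ℝ, EuclideanSpace ℝ (Fin 2))) 𝓘(ℝ, ℝ × ℂ × ℝ) ∞ handleInv q :=
  contMDiffAt_handleInv hq.1

/-- The handle is mirror-symmetric. [folklore] -/
theorem mirror_mem_Hset {q : sphere (0 : EuclideanSpace ℝ (Fin 3)) 1 × EuclideanSpace ℝ (Fin 2)}
    (hq : q ∈ Hset) : (mirrorS2 q.1, q.2) ∈ Hset := by
  have hq' : q ∈ handleMap '' Ubox := by rw [image_handleMap_Ubox]; exact hq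
  obtain ⟨u, hu, rfl⟩ := hq'
  obtain ⟨s, ζ, c⟩ := u
  have hu' : ((1 - s, ζ, c) : ℝ × ℂ × ℝ) ∈ Ubox :=
    ⟨⟨by linarith [hu.1.2], by linarith [hu.1.1]⟩, hu.2.1, hu.2.2⟩
  rw [← handleMap_one_sub]
  exact handleMap_mem_Hset hu'

end IwaseHandle
end Literature.Topology.FourManifolds
end
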